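import Mathlib
import Summits.MatrixMultiplication.MatrixMultiplication.Theses.ProbeRankThreshold

/-!
# Birth skeleton — crux `AmortizedBlockStrictness` (stmt-MatrixMultiplication-18270)

Two regimes of the rank-sum budget `p` against the block size `m ≤ b`:
* `stub_amortizedRankFloor` (LARGE BUDGET `p ≥ m`): over many copies the rank of `s⊙⟨m,m,m⟩`
  exceeds the flattening bound `s·m²` by a factor `1 + κ(b)·(m−1)` (amortized rank floor for the
  finitely many formats `2 ≤ m ≤ b`; equality `r ≥ s` at `m = 1`); no probe restriction at all.
* `stub_smallBudgetStrictness` (SMALL BUDGET `2 ≤ p < m`, the aggregation regime): the content.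
Composition `AmortizedBlockStrictness_of`: `γ := min γ₁ (log_B (1+κ))`, `B = max b 2`; for
`p ≥ m`, `r·p^{1−γ} ≥ s m²(1+κ(m−1))·m^{1−γ} ≥ s m²·m^γ·m^{1−γ} = s m³`.
-/

namespace Summit.MatrixMultiplication.MatrixMultiplication.Cruxes.AmortizedBlockStrictness.Birth

open scoped BigOperators
open Literature.Computability.AlgebraicComplexity
open Summit.MatrixMultiplication.MatrixMultiplication.Theses.ProbeRankThreshold

/-- stub (large budget): AMORTIZED RANK FLOOR for bounded formats — for every `b` there is
`κ > 0` such that every decomposition of `s⊙⟨m,m,m⟩` (`1 ≤ m ≤ b`, any `s`, no probe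
restriction) has `r ≥ s·m²·(1 + κ(m−1))` terms (flattening gives `s·m²`; the substitution /
Koszul-flattening bounds `2m² − 1`, `2m² − m` per copy are the expected source, additivity over
copies being the issue: it follows from Strassen's additivity conjecture for copies of `⟨m⟩`
(BCS1997 Prop. 14.23, Rem. 14.24(1), Problem 14.2, p. 360/374; Winograd's extended direct sum
conjecture, Problem 14.3) — open, Shitov 2019 refutes additivity only for other tensors; and it
is consistent with `ω = 2` (it asks `> m²` per copy by a constant factor only for `m ≤ b`). -/
theorem stub_amortizedRankFloor :
    ∀ b : ℕ, ∃ κ : ℝ, 0 < κ ∧ ∀ (s m r : ℕ), 1 ≤ m → m ≤ b →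
      ∀ (w u v : Fin r → Fin s × (Fin m × Fin m) → ℂ),
        kroneckerTensor (unitTensor ℂ s) (matMulTensor ℂ m m m) = ∑ i, triad (w i) (u i) (v i) →
        (s : ℝ) * (m : ℝ) ^ 2 * (1 + κ * ((m : ℝ) - 1)) ≤ (r : ℝ) := by
  sorry

/-- stub (small budget `2 ≤ p < m`, many copies): amortized strictness of the direct-sum X-rank
law in the aggregation regime — the content of the crux. -/
theorem stub_smallBudgetStrictness :
    ∀ b : ℕ, ∃ γ : ℝ, 0 < γ ∧ ∃ S₀ : ℕ, ∀ (s m p r : ℕ), S₀ ≤ s → 1 ≤ m → m ≤ b → 2 ≤ p →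
      p < m →
      ∀ (w u v : Fin r → Fin s × (Fin m × Fin m) → ℂ),
        kroneckerTensor (unitTensor ℂ s) (matMulTensor ℂ m m m) = ∑ i, triad (w i) (u i) (v i) →
        (∀ i, ∑ c : Fin s, (Matrix.of fun p' q => w i (c, (p', q))).rank ≤ p ∧
          ∑ c : Fin s, (Matrix.of fun p' q => u i (c, (p', q))).rank ≤ p ∧
          ∑ c : Fin s, (Matrix.of fun p' q => v i (c, (p', q))).rank ≤ p) →
        ((s * m ^ 3 : ℕ) : ℝ) ≤ (r : ℝ) * (p : ℝ) ^ (1 - γ) := by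
  sorry

/-- Composition (sorry-free, explicit hypotheses = the two stub statements; conclusion = the
literal body of the route decl `AmortizedBlockStrictness`). -/
theorem AmortizedBlockStrictness_of_stubs
    (hK : ∀ b : ℕ, ∃ κ : ℝ, 0 < κ ∧ ∀ (s m r : ℕ), 1 ≤ m → m ≤ b →
      ∀ (w u v : Fin r → Fin s × (Fin m × Fin m) → ℂ),
        kroneckerTensor (unitTensor ℂ s) (matMulTensor ℂ m m m) = ∑ i, triad (w i) (u i) (v i) →
        (s : ℝ) * (m : ℝ) ^ 2 * (1 + κ * ((m : ℝ) - 1)) ≤ (r : ℝ))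
    (hA : ∀ b : ℕ, ∃ γ : ℝ, 0 < γ ∧ ∃ S₀ : ℕ, ∀ (s m p r : ℕ), S₀ ≤ s → 1 ≤ m → m ≤ b → 2 ≤ p →
      p < m →
      ∀ (w u v : Fin r → Fin s × (Fin m × Fin m) → ℂ),
        kroneckerTensor (unitTensor ℂ s) (matMulTensor ℂ m m m) = ∑ i, triad (w i) (u i) (v i) →
        (∀ i, ∑ c : Fin s, (Matrix.of fun p' q => w i (c, (p', q))).rank ≤ p ∧
          ∑ c : Fin s, (Matrix.of fun p' q => u i (c, (p', q))).rank ≤ p ∧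
          ∑ c : Fin s, (Matrix.of fun p' q => v i (c, (p', q))).rank ≤ p) →
        ((s * m ^ 3 : ℕ) : ℝ) ≤ (r : ℝ) * (p : ℝ) ^ (1 - γ)) :
    (∀ b : ℕ, ∃ γ : ℝ, 0 < γ ∧ ∃ S₀ : ℕ, ∀ (s m p r : ℕ), S₀ ≤ s → 1 ≤ m → m ≤ b → 2 ≤ p → ∀ (w u v : Fin r → Fin s × (Fin m × Fin m) → ℂ), Literature.Computability.AlgebraicComplexity.kroneckerTensor (Literature.Computability.AlgebraicComplexity.unitTensor ℂ s) (Literature.Computability.AlgebraicComplexity.matMulTensor ℂ m m m) = ∑ i, Literature.Computability.AlgebraicComplexity.triad (w i) (u i) (v i) → (∀ i, ∑ c : Fin s, (Matrix.of fun p' q => w i (c, (p', q))).rank ≤ p ∧ ∑ c : Fin s, (Matrix.of fun p' q => u i (c, (p', q))).rank ≤ p ∧ ∑ c : Fin s, (Matrix.of fun p' q => v i (c, (p', q))).rank ≤ p) → ((s * m ^ 3 : ℕ) : ℝ) ≤ (r : ℝ) * (p : ℝ) ^ (1 - γ)) := by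
  intro b
  obtain ⟨κ, hκ, hfloor⟩ := hK b
  obtain ⟨γ₁, hγ₁, S₀, hsmall⟩ := hA b
  -- the large-budget exponent `γ₂ = log_B (1 + κ)`, `B = max b 2`
  set B : ℝ := max (b : ℝ) 2 with hBdef
  have hB2 : (2 : ℝ) ≤ B := le_max_right _ _
  have hB1 : (1 : ℝ) < B := by linarith
  have hBpos : (0 : ℝ) < B := by linarith
  set γ₂ : ℝ := Real.logb B (1 + κ) with hγ₂def
  have hγ₂ : 0 < γ₂ := Real.logb_pos hB1 (by linarith)
  have hBγ : B ^ γ₂ = 1 + κ := Real.rpow_logb hBpos hB1.ne' (by linarith)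
  -- `γ := min (min γ₁ γ₂) (1/2)`
  set γ : ℝ := min (min γ₁ γ₂) (1 / 2) with hγdef
  have hγpos : 0 < γ := lt_min (lt_min hγ₁ hγ₂) (by norm_num)
  have hγle₁ : γ ≤ γ₁ := le_trans (min_le_left _ _) (min_le_left _ _)
  have hγle₂ : γ ≤ γ₂ := le_trans (min_le_left _ _) (min_le_right _ _)
  have hγhalf : γ ≤ 1 / 2 := min_le_right _ _
  refine ⟨γ, hγpos, S₀, ?_⟩
  intro s m p r hs hm hmb hp w u v hdec hrk
  have hp1 : (1 : ℝ) ≤ (p : ℝ) := by exact_mod_cast (le_trans (by norm_num) hp)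
  rcases Nat.lt_or_ge p m with hpm | hpm
  · -- small budget: the stub, with the exponent weakened from `γ₁` to `γ`
    have h := hsmall s m p r hs hm hmb hp hpm w u v hdec hrk
    have hmono : (p : ℝ) ^ (1 - γ₁) ≤ (p : ℝ) ^ (1 - γ) :=
      Real.rpow_le_rpow_of_exponent_le hp1 (by linarith)
    exact h.trans (mul_le_mul_of_nonneg_left hmono (Nat.cast_nonneg _))
  · -- large budget `p ≥ m`: the amortized rank floor
    have hfl := hfloor s m r hm hmb w u v hdec
    have hm1 : (1 : ℝ) ≤ (m : ℝ) := by exact_mod_cast hm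
    have hmpos : (0 : ℝ) < (m : ℝ) := by linarith
    -- `m^γ ≤ 1 + κ(m−1)`
    have hκm : (m : ℝ) ^ γ ≤ 1 + κ * ((m : ℝ) - 1) := by
      rcases Nat.eq_or_lt_of_le hm with hm1' | hm2
      · -- `m = 1`
        have : (m : ℝ) = 1 := by exact_mod_cast hm1'.symm
        rw [this, Real.one_rpow]
        simp
      · -- `m ≥ 2`: `m^γ ≤ B^γ ≤ B^{γ₂} = 1 + κ ≤ 1 + κ(m−1)`
        have hm2R : (2 : ℝ) ≤ (m : ℝ) := by exact_mod_cast hm2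
        have hmB : (m : ℝ) ≤ B := le_trans (by exact_mod_cast hmb) (le_max_left _ _)
        calc (m : ℝ) ^ γ ≤ B ^ γ := Real.rpow_le_rpow hmpos.le hmB hγpos.le
          _ ≤ B ^ γ₂ := Real.rpow_le_rpow_of_exponent_le hB1.le hγle₂
          _ = 1 + κ := hBγ
          _ ≤ 1 + κ * ((m : ℝ) - 1) := by nlinarith
    have hsplit : (m : ℝ) ^ γ * (m : ℝ) ^ (1 - γ) = m := by
      rw [← Real.rpow_add hmpos]
      norm_num
    have hmp : (m : ℝ) ^ (1 - γ) ≤ (p : ℝ) ^ (1 - γ) :=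
      Real.rpow_le_rpow hmpos.le (by exact_mod_cast hpm) (by linarith)
    have hr1γ : (0 : ℝ) ≤ (m : ℝ) ^ (1 - γ) := Real.rpow_nonneg hmpos.le _
    have hs0 : (0 : ℝ) ≤ (s : ℝ) := Nat.cast_nonneg _
    calc ((s * m ^ 3 : ℕ) : ℝ) = (s : ℝ) * (m : ℝ) ^ 2 * ((m : ℝ) ^ γ * (m : ℝ) ^ (1 - γ)) := by
          rw [hsplit]; push_cast; ring
      _ ≤ (s : ℝ) * (m : ℝ) ^ 2 * ((1 + κ * ((m : ℝ) - 1)) * (m : ℝ) ^ (1 - γ)) :=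
          mul_le_mul_of_nonneg_left (mul_le_mul_of_nonneg_right hκm hr1γ) (by positivity)
      _ = ((s : ℝ) * (m : ℝ) ^ 2 * (1 + κ * ((m : ℝ) - 1))) * (m : ℝ) ^ (1 - γ) := by ring
      _ ≤ (r : ℝ) * (m : ℝ) ^ (1 - γ) := mul_le_mul_of_nonneg_right hfl hr1γ
      _ ≤ (r : ℝ) * (p : ℝ) ^ (1 - γ) := mul_le_mul_of_nonneg_left hmp (Nat.cast_nonneg _)

/-- THE skeleton theorem: the crux BY NAME from the two declared stubs (the only `sorry`s of the
file) through the sorry-free composition `AmortizedBlockStrictness_of_stubs`. [folklore] -/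
theorem AmortizedBlockStrictness_of : AmortizedBlockStrictness :=
  AmortizedBlockStrictness_of_stubs stub_amortizedRankFloor stub_smallBudgetStrictness

end Summit.MatrixMultiplication.MatrixMultiplication.Cruxes.AmortizedBlockStrictness.Birth
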